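import Mathlib.MeasureTheory.Integral.Bochner.Set
import Mathlib.MeasureTheory.Measure.Real
import HarnessLib

/-!
# A forbidden band of the average from one- and two-point phase-separation bounds

Third (model-independent) layer under the named fact
`Literature.MathematicalPhysics.QuantumLattice.enterShlosman_narrowWell_firstOrderTransition`
(van Enter–Shlosman 2005, Thm. 2), complementing
`Literature/Probability/LatticeModels/ForbiddenGapFirstOrder.lean`: the step of the
Kotecký–Shlosman / van Enter–Shlosman argument that converts the OUTPUT of the chessboard–Peierls
estimates — "intermediate local variables are rare" (one-point bound) and "an ordered and a
disordered local variable rarely coexist in the same configuration" (two-point bound, uniformly in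
the pair) — into the forbidden band for the empirical average consumed by
`ForbiddenGap.exists_not_differentiableAt_of_forbidden_band`.

* **`measureReal_avg_mem_Ioo_le`**: for finitely many random variables `w_q ∈ [0, 1]` on a
  probability space, thresholds `δs < 1 - δ₁` (disordered: `w ≤ δs`; ordered: `w ≥ 1 - δ₁`;
  intermediate: in between), if `μ(w_q intermediate) ≤ ε₁` for all `q` and
  `μ(w_q ordered ∧ w_{q'} disordered) ≤ ε₂` for all `q, q'`, then for `a - η - δs > 0` and
  `1 - b/(1 - δ₁) - η > 0`,
  `μ(n⁻¹ Σ_q w_q ∈ (a, b)) ≤ ε₁/η + ε₂ / ((a - η - δs)(1 - b/(1-δ₁) - η))`.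
  Proof: on the band event either at least `η n` variables are intermediate (Markov on their
  number, mean `≤ ε₁ n`), or the numbers `X` of ordered and `Y` of disordered variables satisfy
  `X Y ≥ (a - η - δs)(1 - b/(1-δ₁) - η) n²` (Markov on `X Y`, mean `≤ ε₂ n²`).

Everything is proved; no named facts (D-0014, D-0026). This is the finite-volume form of the
remark "ordered and disordered bonds are unlikely to occur in the same configuration … this
immediately implies coexistence" (van Enter–Shlosman; Biskup–Kotecký 2006 §2.4).

## References

* A. C. D. van Enter, S. B. Shlosman, Comm. Math. Phys. 255 (2005) 21–32 [VanEnterShlosman2005].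
* M. Biskup, R. Kotecký, Comm. Math. Phys. 264 (2006) 631–656, §2.4 [BiskupKotecky2006].
* R. Kotecký, S. B. Shlosman, Comm. Math. Phys. 83 (1982) 493–515 [KoteckyShlosman1982].
-/

noncomputable section

namespace Literature.Probability.LatticeModels

open _root_.MeasureTheory _root_.Set

namespace ForbiddenGap

variable {Ω : Type*} [MeasurableSpace Ω] {μ : Measure Ω} [IsProbabilityMeasure μ]
  {Q : Type*} [Fintype Q] {w : Q → Ω → ℝ}

/-- Markov's inequality for a sum of indicators of measurable sets: `μ(Σ_q 𝟙_{S_q} ≥ t) ≤ (Σ_q μ(S_q)) / t`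
for `t > 0`. [folklore] -/
theorem measureReal_sum_indicator_ge_le {ι : Type*} (s : Finset ι) {S : ι → Set Ω}
    (hS : ∀ i, MeasurableSet (S i)) {t : ℝ} (ht : 0 < t) :
    μ.real {ω | t ≤ ∑ i ∈ s, (S i).indicator (1 : Ω → ℝ) ω} ≤ (∑ i ∈ s, μ.real (S i)) / t := by
  have hint : ∀ i, Integrable ((S i).indicator (1 : Ω → ℝ)) μ := fun i =>
    (integrable_const (1 : ℝ)).indicator (hS i)
  have hsum : Integrable (fun ω => ∑ i ∈ s, (S i).indicator (1 : Ω → ℝ) ω) μ :=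
    integrable_finsetSum s fun i _ => hint i
  have hnonneg : 0 ≤ᵐ[μ] fun ω => ∑ i ∈ s, (S i).indicator (1 : Ω → ℝ) ω :=
    ae_of_all _ fun ω => Finset.sum_nonneg fun i _ =>
      Set.indicator_nonneg (fun _ _ => zero_le_one) ω
  have h := mul_meas_ge_le_integral_of_nonneg hnonneg hsum t
  rw [integral_finsetSum s fun i _ => hint i] at h
  simp_rw [integral_indicator_one (hS _)] at h
  rw [le_div_iff₀ ht, mul_comm]
  exact h

/-- **A forbidden band of the average from one- and two-point phase-separation bounds.**
Let `w_q : Ω → [0, 1]`, `q ∈ Q` finite, be measurable on a probability space; call `q` ordered if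
`w_q ≥ 1 - δ₁`, disordered if `w_q ≤ δs`, intermediate otherwise (`δs < 1 - δ₁`). If every `q` is
intermediate with probability `≤ ε₁` and every pair `(q, q')` is (ordered, disordered) with
probability `≤ ε₂`, then the empirical average avoids the band `(a, b)`:
`μ(|Q|⁻¹ Σ_q w_q ∈ (a, b)) ≤ ε₁/η + ε₂/((a - η - δs)(1 - b/(1-δ₁) - η))` whenever the two
bracketed margins are positive. [folklore] -/
theorem measureReal_avg_mem_Ioo_le (hw : ∀ q, Measurable (w q)) (hw0 : ∀ q ω, 0 ≤ w q ω)
    (hw1 : ∀ q ω, w q ω ≤ 1) {δs δ₁ η a b ε₁ ε₂ : ℝ} (hδs : 0 ≤ δs) (hsep : δs < 1 - δ₁)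
    (hη : 0 < η) (hA : 0 < a - η - δs) (hB : 0 < 1 - b / (1 - δ₁) - η) (hε₁ : 0 ≤ ε₁)
    (hε₂ : 0 ≤ ε₂)
    (hint : ∀ q, μ.real {ω | δs < w q ω ∧ w q ω < 1 - δ₁} ≤ ε₁)
    (htwo : ∀ q q', μ.real {ω | 1 - δ₁ ≤ w q ω ∧ w q' ω ≤ δs} ≤ ε₂) :
    μ.real {ω | (∑ q, w q ω) / Fintype.card Q ∈ Ioo a b} ≤
      ε₁ / η + ε₂ / ((a - η - δs) * (1 - b / (1 - δ₁) - η)) := by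
  classical
  set n : ℕ := Fintype.card Q with hn
  set c : ℝ := (a - η - δs) * (1 - b / (1 - δ₁) - η) with hc
  have hcpos : 0 < c := mul_pos hA hB
  have hδ₁ : 0 < 1 - δ₁ := lt_of_le_of_lt hδs hsep
  have hRHS : 0 ≤ ε₁ / η + ε₂ / c := add_nonneg (div_nonneg hε₁ hη.le) (div_nonneg hε₂ hcpos.le)
  -- the empty index set
  rcases Nat.eq_zero_or_pos n with hn0 | hnpos
  · have hempty : {ω | (∑ q, w q ω) / Fintype.card Q ∈ Ioo a b} = ∅ := by
      ext ω
      simp only [mem_setOf_eq, mem_Ioo, mem_empty_iff_false, iff_false, not_and, not_lt]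
      intro ha
      rw [← hn, hn0, Nat.cast_zero, div_zero] at ha
      linarith
    rw [hempty, measureReal_empty]
    exact hRHS
  have hnR : (0 : ℝ) < n := by exact_mod_cast hnpos
  -- the three families of events and their counting functions
  set SO : Q → Set Ω := fun q => {ω | 1 - δ₁ ≤ w q ω} with hSO
  set SD : Q → Set Ω := fun q => {ω | w q ω ≤ δs} with hSD
  set SI : Q → Set Ω := fun q => {ω | δs < w q ω ∧ w q ω < 1 - δ₁} with hSI
  have hSOm : ∀ q, MeasurableSet (SO q) := fun q => measurableSet_le measurable_const (hw q)
  have hSDm : ∀ q, MeasurableSet (SD q) := fun q => measurableSet_le (hw q) measurable_const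
  have hSIm : ∀ q, MeasurableSet (SI q) := fun q =>
    (measurableSet_lt measurable_const (hw q)).inter (measurableSet_lt (hw q) measurable_const)
  set X : Ω → ℝ := fun ω => ∑ q, (SO q).indicator 1 ω with hX
  set Y : Ω → ℝ := fun ω => ∑ q, (SD q).indicator 1 ω with hY
  set I : Ω → ℝ := fun ω => ∑ q, (SI q).indicator 1 ω with hI
  -- pointwise bookkeeping, one variable at a time
  have hpt : ∀ q ω, (SO q).indicator (1 : Ω → ℝ) ω + (SD q).indicator 1 ω + (SI q).indicator 1 ω = 1 ∧
      w q ω ≤ (SO q).indicator (1 : Ω → ℝ) ω + (SI q).indicator 1 ω + δs * (SD q).indicator 1 ω ∧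
      (1 - δ₁) * (SO q).indicator (1 : Ω → ℝ) ω ≤ w q ω := by
    intro q ω
    have h0 := hw0 q ω
    have h1 := hw1 q ω
    simp only [hSO, hSD, hSI, Set.indicator_apply, mem_setOf_eq, Pi.one_apply]
    by_cases hO : 1 - δ₁ ≤ w q ω
    · have hD : ¬ w q ω ≤ δs := fun h => by linarith
      have hI : ¬ (δs < w q ω ∧ w q ω < 1 - δ₁) := fun h => by linarith [h.2]
      simp only [hO, hD, hI, if_true, if_false]
      refine ⟨by ring, by linarith, by linarith⟩
    · by_cases hD : w q ω ≤ δs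
      · have hI : ¬ (δs < w q ω ∧ w q ω < 1 - δ₁) := fun h => by linarith [h.1]
        simp only [hO, hD, hI, if_true, if_false]
        refine ⟨by ring, by linarith, by linarith⟩
      · have hI : δs < w q ω ∧ w q ω < 1 - δ₁ := ⟨lt_of_not_ge hD, lt_of_not_ge hO⟩
        simp only [hO, hD, hI, if_true, if_false, and_self]
        refine ⟨by ring, by linarith, by nlinarith⟩
  have hpart : ∀ ω, X ω + Y ω + I ω = n := by
    intro ω
    simp only [hX, hY, hI, ← Finset.sum_add_distrib]
    rw [Finset.sum_congr rfl fun q _ => (hpt q ω).1]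
    simp [hn]
  have hup : ∀ ω, ∑ q, w q ω ≤ X ω + I ω + δs * Y ω := by
    intro ω
    simp only [hX, hY, hI, Finset.mul_sum, ← Finset.sum_add_distrib]
    exact Finset.sum_le_sum fun q _ => (hpt q ω).2.1
  have hlow : ∀ ω, (1 - δ₁) * X ω ≤ ∑ q, w q ω := by
    intro ω
    simp only [hX, Finset.mul_sum]
    exact Finset.sum_le_sum fun q _ => (hpt q ω).2.2
  have hYle : ∀ ω, Y ω ≤ n := by
    intro ω
    have hX0 : 0 ≤ X ω := Finset.sum_nonneg fun q _ => Set.indicator_nonneg (fun _ _ => zero_le_one) ω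
    have hI0 : 0 ≤ I ω := Finset.sum_nonneg fun q _ => Set.indicator_nonneg (fun _ _ => zero_le_one) ω
    linarith [hpart ω]
  -- the band event forces many intermediate variables or a large product `X · Y`
  have hincl : {ω | (∑ q, w q ω) / Fintype.card Q ∈ Ioo a b} ⊆
      {ω | η * n ≤ I ω} ∪ {ω | c * n ^ 2 ≤ X ω * Y ω} := by
    intro ω hω
    simp only [mem_setOf_eq, mem_Ioo, ← hn] at hω
    obtain ⟨ha, hb⟩ := hω
    rw [lt_div_iff₀ hnR] at ha
    rw [div_lt_iff₀ hnR] at hb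
    by_cases hIω : η * n ≤ I ω
    · exact Or.inl hIω
    · right
      simp only [mem_setOf_eq]
      simp only [not_le] at hIω
      have hYn := hYle ω
      have h1 : (a - η - δs) * n ≤ X ω := by nlinarith [hup ω, hYle ω]
      have h2 : X ω < b * n / (1 - δ₁) := by
        rw [lt_div_iff₀ hδ₁]
        nlinarith [hlow ω]
      have h3 : (1 - b / (1 - δ₁) - η) * n ≤ Y ω := by
        have : Y ω = n - X ω - I ω := by linarith [hpart ω]
        rw [this]
        have h2' : X ω ≤ b / (1 - δ₁) * n := by
          rw [div_mul_eq_mul_div]; exact h2.le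
        nlinarith
      calc c * (n : ℝ) ^ 2 = ((a - η - δs) * n) * ((1 - b / (1 - δ₁) - η) * n) := by
            rw [hc]; ring
        _ ≤ X ω * Y ω := mul_le_mul h1 h3 (by positivity)
            ((mul_nonneg hA.le hnR.le).trans h1)
  -- Markov for the number of intermediate variables
  have hMI : μ.real {ω | η * n ≤ I ω} ≤ ε₁ / η := by
    have h := measureReal_sum_indicator_ge_le (μ := μ) Finset.univ hSIm (mul_pos hη hnR)
    refine h.trans ?_
    rw [div_le_div_iff₀ (mul_pos hη hnR) hη]
    calc (∑ q, μ.real (SI q)) * η ≤ (∑ _q : Q, ε₁) * η :=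
          mul_le_mul_of_nonneg_right (Finset.sum_le_sum fun q _ => hint q) hη.le
      _ = ε₁ * (η * n) := by
          rw [Finset.sum_const, Finset.card_univ, nsmul_eq_mul, ← hn]; ring
  -- Markov for `X · Y`, a sum of indicators of the pair events
  have hXY : ∀ ω, X ω * Y ω = ∑ qq' : Q × Q, (SO qq'.1 ∩ SD qq'.2).indicator (1 : Ω → ℝ) ω := by
    intro ω
    simp only [hX, hY, Finset.sum_mul_sum, ← Finset.univ_product_univ, Finset.sum_product]
    refine Finset.sum_congr rfl fun q _ => Finset.sum_congr rfl fun q' _ => ?_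
    rw [Set.inter_indicator_one]
    rfl
  have hMXY : μ.real {ω | c * n ^ 2 ≤ X ω * Y ω} ≤ ε₂ / c := by
    have hSm : ∀ qq' : Q × Q, MeasurableSet (SO qq'.1 ∩ SD qq'.2) := fun qq' =>
      (hSOm _).inter (hSDm _)
    have h := measureReal_sum_indicator_ge_le (μ := μ) (Finset.univ : Finset (Q × Q)) hSm
      (mul_pos hcpos (pow_pos hnR 2))
    simp_rw [← hXY] at h
    refine h.trans ?_
    rw [div_le_div_iff₀ (mul_pos hcpos (pow_pos hnR 2)) hcpos]
    calc (∑ qq' : Q × Q, μ.real (SO qq'.1 ∩ SD qq'.2)) * c ≤ (∑ _qq' : Q × Q, ε₂) * c := by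
          refine mul_le_mul_of_nonneg_right (Finset.sum_le_sum fun qq' _ => ?_) hcpos.le
          exact le_trans (le_of_eq (by rfl)) (htwo qq'.1 qq'.2)
      _ = ε₂ * (c * n ^ 2) := by
          rw [Finset.sum_const, Finset.card_univ, nsmul_eq_mul, Fintype.card_prod, ← hn]
          push_cast; ring
  calc μ.real {ω | (∑ q, w q ω) / Fintype.card Q ∈ Ioo a b}
      ≤ μ.real ({ω | η * n ≤ I ω} ∪ {ω | c * n ^ 2 ≤ X ω * Y ω}) := measureReal_mono hincl
    _ ≤ μ.real {ω | η * n ≤ I ω} + μ.real {ω | c * n ^ 2 ≤ X ω * Y ω} := measureReal_union_le _ _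
    _ ≤ ε₁ / η + ε₂ / c := add_le_add hMI hMXY

end ForbiddenGap

end Literature.Probability.LatticeModels

end
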